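import Literature.NumberTheory.ComplexMultiplication.CMPolarisationFrobeniusTransport
import Literature.NumberTheory.ComplexMultiplication.CMTypeUniformizationTransport
import HarnessLib

/-!
# Main theorem of complex multiplication — uniformisations along the tower `L ⊆ L₁ ⊆ ℂ` and along
# `((A₀ ⊗_L L₁)^γ) ⊗ ℂ ≅ (A₀ ⊗ ℂ)^σ` (glue for the level-`N` structure, Shimura 1998 §18.6)

[Shimura1998] G. Shimura, *Abelian Varieties with Complex Multiplication and Modular Functions*, Princeton 1998,
§18.6, proof of Thm. 18.6, p. 165 («we may assume that `A`, `A_i`, `ι`, `η_i` are rational over an algebraic number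
field `k`» — and, tacitly, over any finite extension of it) and pp. 128–130 («`A^σ`, `t^σ` computed on the model»).

Topic: GLUE for the assembly of row II-1 S7a `levelStructure` (cell `hodgecm-mathlib`, D-0151; B-p12's pieces
G0/G12): the main theorem's data `ξ` (a uniformisation of `A₀ ⊗_L ℂ`) and the conjugate `(A₀ ⊗ ℂ)^σ` refer to the
ORIGINAL field of definition `L`, while S5 (`CMPolarisationFrobeniusTransport`), the congruence relation and the
TT-idèle step are run on the MODEL `A₀ ⊗_L L₁` over a common Galois number field `L₁ ⊇ L` with `γ = σ|_{L₁}`.  This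
file moves uniformisations across the two canonical isomorphisms
* `T = baseChangeTowerIso L L₁ ℂ A₀ : (A₀ ⊗_L L₁) ⊗ ℂ ≅ A₀ ⊗ ℂ` (transitivity of base change), and
* `E = e₁ ≫ T^σ : ((A₀ ⊗_L L₁)^γ) ⊗ ℂ ≅ ((A₀ ⊗_L L₁) ⊗ ℂ)^σ ≅ (A₀ ⊗ ℂ)^σ`
  (`e₁ = conjugateBaseChangeAlongIso γ σ hσ (A₀ ⊗_L L₁)` of `Motives/AbelianVarietyConjugateBaseChangeAlong`),
recording the `𝓞_K`-equivariance of both and the resulting torsion parametrisations `r` — exactly the hypotheses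
`hT` of `MainTheoremCMLevelPairTransport.weilPairingLevel_eq_pow_of_source_transport` and (after the reindex of
`MainTheoremCMLevelTorsionTransport`) `hE` of `….weilPairingLevel_reindex_transport_eq_pow`.
Theorems only: no definition, no instance, no named fact (the isomorphism `T^σ` is built inside the proofs).

## Main statements
* `CMTypeUniformization.exists_tower_source` — from `ξ` on `A₀ ⊗ ℂ` a `ξ₁` on `(A₀ ⊗_L L₁) ⊗ ℂ` of the same type with
  `ξ(x) = T(ξ₁(x))`.
* `AbelianVariety.exists_iso_conjugate_baseChange_tower` — the isomorphism `E` with `E.hom = e₁ ≫ T^σ`, `𝓞_K`-equivariant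
  for the structures `((ι₀ ⊗ L₁)^γ) ⊗ ℂ` and `((ι₀ ⊗ ℂ))^σ`.
* `CMTypeUniformization.exists_conjugate_tower_target` — from `ξ*` on `((A₀ ⊗_L L₁)^γ) ⊗ ℂ` a `ξ₂` on `(A₀ ⊗ ℂ)^σ` of
  the same type with `ξ₂(x) = (e₁ ≫ T^σ)(ξ*(x))`.
* `CMTypeUniformization.exists_conjugate_tower_target_of_pair` — the same starting from Shimura's pair `(λ, θ)`:
  `η` on `Aᵢ ⊗ ℂ` with `λ_ℂ ∘ ξ₁ = η`, `θ : Aᵢ ≅ (A₀ ⊗_L L₁)^γ` equivariant ⟹ `ξ₂` with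
  `ξ₂(u) = (e₁ ≫ T^σ)((λ ≫ θ)_ℂ(ξ₁(u)))` (§13 of the S7a assembly).
HC_CM is proved only modulo the printed citations until rung 0 closes.
-/

noncomputable section

open CategoryTheory CategoryTheory.Limits AlgebraicGeometry NumberField IsDedekindDomain
open scoped NumberField nonZeroDivisors
open Literature.AlgebraicGeometry.Motives Literature.AlgebraicGeometry.Motives.AbelianVariety

namespace Literature.NumberTheory.ComplexMultiplication

variable {K : Type} [Field K] [NumberField K] {Φ : CMType K} {𝔞 𝔠 : (FractionalIdeal (𝓞 K)⁰ K)ˣ}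
  {L L₁ : Type} [Field L] [Field L₁] [Algebra L L₁] [Algebra L₁ ℂ] [Algebra L ℂ] [IsScalarTower L L₁ ℂ]
  (A₀ : AbelianVariety L) (ι₀ : 𝓞 K →+* End A₀)

omit [NumberField K] in
/-- **The tower isomorphism is `𝓞_K`-equivariant** for the structures `(ι₀ ⊗ L₁) ⊗ ℂ` on `(A₀ ⊗_L L₁) ⊗ ℂ` and
`ι₀ ⊗ ℂ` on `A₀ ⊗ ℂ` (naturality of `T` in homomorphisms, Mumford §19). [cite: MumfordAV1970, §19 (p. 176)]
[cite: GortzWedhorn2020, Prop. 4.16 and Remark 16.54] -/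
theorem AbelianVariety.endBaseChange_tower_comp_baseChangeTowerIso_hom (a : 𝓞 K) :
    ((endBaseChange ℂ (A₀.baseChange L₁)).comp ((endBaseChange L₁ A₀).comp ι₀)) a ≫
        (baseChangeTowerIso L L₁ ℂ A₀).hom =
      (baseChangeTowerIso L L₁ ℂ A₀).hom ≫ ((endBaseChange ℂ A₀).comp ι₀) a :=
  Hom.baseChange_baseChange_comp_baseChangeTowerIso_hom L₁ ℂ (ι₀ a)

/-- **Uniformisations descend the tower on the source side**: a uniformisation `ξ` of `A₀ ⊗_L ℂ` of type `(K, Φ; 𝔞)`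
gives a uniformisation `ξ₁ = T⁻¹ ∘ ξ` of `(A₀ ⊗_L L₁) ⊗ ℂ` of the same type with `ξ(x) = T(ξ₁(x))` for all `x ∈ K`
(Shimura's tacit «any field of definition will do»: the structure is read on the complex points, which `T`
identifies). This is the `hT` of `weilPairingLevel_eq_pow_of_source_transport`.
[cite: Shimura1998, §18.6 proof of Thm. 18.6, p. 165] [cite: GortzWedhorn2020, Prop. 4.16 and §(4.8)] -/
theorem CMTypeUniformization.exists_tower_source
    (ξ : CMTypeUniformization Φ 𝔞 (A₀.baseChange ℂ) ((endBaseChange ℂ A₀).comp ι₀)) :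
    ∃ ξ₁ : CMTypeUniformization Φ 𝔞 ((A₀.baseChange L₁).baseChange ℂ)
        ((endBaseChange ℂ (A₀.baseChange L₁)).comp ((endBaseChange L₁ A₀).comp ι₀)),
      ∀ x : K, ξ.r x = AlgPoints.map (baseChangeTowerIso L L₁ ℂ A₀).hom.hom.hom.hom (ξ₁.r x) := by
  refine ⟨ξ.ofIso (baseChangeTowerIso L L₁ ℂ A₀).symm
    (CMTypeUniformization.comm_symm_of_comm _
      (AbelianVariety.endBaseChange_tower_comp_baseChangeTowerIso_hom A₀ ι₀)), fun x => ?_⟩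
  rw [CMTypeUniformization.ofIso_r, Iso.symm_hom, ← AlgPoints.map_comp_apply]
  have h : (baseChangeTowerIso L L₁ ℂ A₀).inv.hom.hom.hom ≫ (baseChangeTowerIso L L₁ ℂ A₀).hom.hom.hom.hom = 𝟙 _ :=
    congr_arg (fun f : A₀.baseChange ℂ ⟶ A₀.baseChange ℂ => f.hom.hom.hom) (baseChangeTowerIso L L₁ ℂ A₀).inv_hom_id
  rw [h, AlgPoints.map_id_apply]

variable (γ : L₁ ≃+* L₁) (σ : ℂ ≃+* ℂ) (hσ : ∀ x : L₁, σ (algebraMap L₁ ℂ x) = algebraMap L₁ ℂ (γ x))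

include hσ in
omit [NumberField K] in
/-- **`E : ((A₀ ⊗_L L₁)^γ) ⊗ ℂ ≅ (A₀ ⊗ ℂ)^σ` with `E = e₁ ≫ T^σ`, `𝓞_K`-equivariantly** for the structures
`((ι₀ ⊗ L₁)^γ) ⊗ ℂ` and `(ι₀ ⊗ ℂ)^σ`: `e₁ = conjugateBaseChangeAlongIso γ σ hσ (A₀ ⊗_L L₁)` is natural
(`Hom.baseChange_conjugate_comp_conjugateBaseChangeAlongIso_hom`) and `T^σ` is the conjugate of the natural tower
isomorphism (Milne's functor `σ`).  In Shimura's proof this is the identification of `A^σ` (complex points of the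
conjugate) with the complexification of the conjugate `A^γ` of the `L₁`-model.
[cite: Shimura1998, §18.6 proof of Thm. 18.6, pp. 128–130] [cite: Milne2005ShimuraVarieties, §11 p. 108 («the functor σ»)] -/
theorem AbelianVariety.exists_iso_conjugate_baseChange_tower :
    ∃ E : ((A₀.baseChange L₁).conjugate γ).baseChange ℂ ≅ (A₀.baseChange ℂ).conjugate σ,
      E.hom = (conjugateBaseChangeAlongIso γ σ hσ (A₀.baseChange L₁)).hom ≫
          Hom.conjugate σ (baseChangeTowerIso L L₁ ℂ A₀).hom ∧
      ∀ a : 𝓞 K,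
        ((endBaseChange ℂ ((A₀.baseChange L₁).conjugate γ)).comp
            (((A₀.baseChange L₁).endConjugate γ).comp ((endBaseChange L₁ A₀).comp ι₀))) a ≫ E.hom =
          E.hom ≫ (((A₀.baseChange ℂ).endConjugate σ).comp ((endBaseChange ℂ A₀).comp ι₀)) a := by
  -- `T^σ` as an isomorphism
  let Tσ : ((A₀.baseChange L₁).baseChange ℂ).conjugate σ ≅ (A₀.baseChange ℂ).conjugate σ :=
    { hom := Hom.conjugate σ (baseChangeTowerIso L L₁ ℂ A₀).hom
      inv := Hom.conjugate σ (baseChangeTowerIso L L₁ ℂ A₀).inv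
      hom_inv_id := by rw [← Hom.conjugate_comp, Iso.hom_inv_id, Hom.conjugate_id]
      inv_hom_id := by rw [← Hom.conjugate_comp, Iso.inv_hom_id, Hom.conjugate_id] }
  refine ⟨conjugateBaseChangeAlongIso γ σ hσ (A₀.baseChange L₁) ≪≫ Tσ, rfl, fun a => ?_⟩
  change Hom.baseChange ℂ (Hom.conjugate γ (Hom.baseChange L₁ (ι₀ a))) ≫
      (conjugateBaseChangeAlongIso γ σ hσ (A₀.baseChange L₁)).hom ≫
        Hom.conjugate σ (baseChangeTowerIso L L₁ ℂ A₀).hom =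
    ((conjugateBaseChangeAlongIso γ σ hσ (A₀.baseChange L₁)).hom ≫
        Hom.conjugate σ (baseChangeTowerIso L L₁ ℂ A₀).hom) ≫
      Hom.conjugate σ (Hom.baseChange ℂ (ι₀ a))
  rw [Hom.baseChange_conjugate_comp_conjugateBaseChangeAlongIso_hom_assoc, Category.assoc, ← Hom.conjugate_comp,
    ← Hom.conjugate_comp, Hom.baseChange_baseChange_comp_baseChangeTowerIso_hom]

include hσ in
/-- **Uniformisations cross to the conjugate on the target side**: a uniformisation `ξ*` of `((A₀ ⊗_L L₁)^γ) ⊗ ℂ` of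
type `(K, Φ; 𝔠)` (S5's `ξ′ = κ_ℂ ∘ ξ` on the model) gives a uniformisation `ξ₂ = E ∘ ξ*` of `(A₀ ⊗ ℂ)^σ` of the same
type, for the structure `(ι₀ ⊗ ℂ)^σ` of the junction `IsLevelUniformization`, with `ξ₂(x) = (e₁ ≫ T^σ)(ξ*(x))` — the
`ξ₂` of `MainTheoremCMLevelTorsionTransport` and, after its reindex, the `hE` of
`weilPairingLevel_reindex_transport_eq_pow` with `E := e₁ ≫ T^σ`.
[cite: Shimura1998, §18.6 proof of Thm. 18.6, pp. 128–130, 169] [cite: Milne2005ShimuraVarieties, §11 p. 108] -/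
theorem CMTypeUniformization.exists_conjugate_tower_target
    (ξs : CMTypeUniformization Φ 𝔠 (((A₀.baseChange L₁).conjugate γ).baseChange ℂ)
      ((endBaseChange ℂ ((A₀.baseChange L₁).conjugate γ)).comp
        (((A₀.baseChange L₁).endConjugate γ).comp ((endBaseChange L₁ A₀).comp ι₀)))) :
    ∃ ξ₂ : CMTypeUniformization Φ 𝔠 ((A₀.baseChange ℂ).conjugate σ)
        (((A₀.baseChange ℂ).endConjugate σ).comp ((endBaseChange ℂ A₀).comp ι₀)),
      ∀ x : K, ξ₂.r x =
        AlgPoints.map ((conjugateBaseChangeAlongIso γ σ hσ (A₀.baseChange L₁)).hom ≫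
          Hom.conjugate σ (baseChangeTowerIso L L₁ ℂ A₀).hom).hom.hom.hom (ξs.r x) := by
  obtain ⟨E, hE, he⟩ := AbelianVariety.exists_iso_conjugate_baseChange_tower A₀ ι₀ γ σ hσ
  exact ⟨ξs.ofIso E he, fun x => by rw [CMTypeUniformization.ofIso_r, hE]⟩

include hσ in
/-- **§13 of the S7a assembly: the junction-carrier uniformisation `ξ₂` from the pair `(λ, θ)`** (Shimura p. 167
L1–13: `κ = ι^σ(ε) ∘ λ = θ ∘ λ : A → A^σ`, «`κ ∘ ξ = ξ* ∘ id`», read on `A^σ = (A₀ ⊗ ℂ)^σ`).  Data on the model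
`A₁ = A₀ ⊗_L L₁`: a uniformisation `ξ₁` of `A₁ ⊗ ℂ`, a structure `(Aᵢ, ιᵢ)` over `L₁` with a uniformisation `η` of
type `𝔠` of `Aᵢ ⊗ ℂ`, a homomorphism `λ : A₁ → Aᵢ` with `λ_ℂ ∘ ξ₁ = η` (`hlam`, [Shimura1998] §7.4 Prop. 15 / the
cell's `exists_hom_forall_map_r_eq`) and an `𝓞_K`-equivariant isomorphism `θ : Aᵢ ≅ A₁^γ` (`hθι`; G10
`MainTheoremCMLevelKappa`).  Then `η` transported along `θ_ℂ = (baseChangeFunctor L₁ ℂ).mapIso θ` and along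
`E = e₁ ≫ T^σ` (`exists_conjugate_tower_target`) is a uniformisation `ξ₂` of `(A₀ ⊗ ℂ)^σ` of type `𝔠` for the junction
structure with **`ξ₂(u) = E((λ ≫ θ)_ℂ(ξ₁(u)))`** for all `u ∈ K` — the hypothesis `hξ₂` of
`MainTheoremCMLevelPairOfModel.weilPairingLevel_conjugate_reindex_eq_pow_of_model` with `κ := λ ≫ θ` and, on
`N`-torsion, the `hG` of `MainTheoremCMLevelStructureOfParts`.
[cite: Shimura1998, §18.6 proof of Thm. 18.6, p. 167 L1–13 and p. 169] [cite: Milne2005ShimuraVarieties, §11 p. 108] -/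
theorem CMTypeUniformization.exists_conjugate_tower_target_of_pair
    {Aᵢ : AbelianVariety L₁} {ιᵢ : 𝓞 K →+* End Aᵢ}
    (ξ₁ : CMTypeUniformization Φ 𝔞 ((A₀.baseChange L₁).baseChange ℂ)
      ((endBaseChange ℂ (A₀.baseChange L₁)).comp ((endBaseChange L₁ A₀).comp ι₀)))
    (η : CMTypeUniformization Φ 𝔠 (Aᵢ.baseChange ℂ) ((endBaseChange ℂ Aᵢ).comp ιᵢ))
    (lam : A₀.baseChange L₁ ⟶ Aᵢ)
    (hlam : ∀ u : K, AlgPoints.map (Hom.baseChange ℂ lam).hom.hom.hom (ξ₁.r u) = η.r u)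
    (θ : Aᵢ ≅ (A₀.baseChange L₁).conjugate γ)
    (hθι : ∀ a : 𝓞 K, ιᵢ a ≫ θ.hom =
      θ.hom ≫ (((A₀.baseChange L₁).endConjugate γ).comp ((endBaseChange L₁ A₀).comp ι₀)) a) :
    ∃ ξ₂ : CMTypeUniformization Φ 𝔠 ((A₀.baseChange ℂ).conjugate σ)
        (((A₀.baseChange ℂ).endConjugate σ).comp ((endBaseChange ℂ A₀).comp ι₀)),
      ∀ u : K, ξ₂.r u =
        AlgPoints.map ((conjugateBaseChangeAlongIso γ σ hσ (A₀.baseChange L₁)).hom ≫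
            Hom.conjugate σ (baseChangeTowerIso L L₁ ℂ A₀).hom).hom.hom.hom
          (AlgPoints.map (Hom.baseChange ℂ (lam ≫ θ.hom)).hom.hom.hom (ξ₁.r u)) := by
  -- `θ_ℂ : Aᵢ ⊗ ℂ ≅ (A₁^γ) ⊗ ℂ` is `𝓞_K`-equivariant
  have hθ : ∀ a : 𝓞 K, ((endBaseChange ℂ Aᵢ).comp ιᵢ) a ≫ ((baseChangeFunctor L₁ ℂ).mapIso θ).hom =
      ((baseChangeFunctor L₁ ℂ).mapIso θ).hom ≫
        ((endBaseChange ℂ ((A₀.baseChange L₁).conjugate γ)).comp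
          (((A₀.baseChange L₁).endConjugate γ).comp ((endBaseChange L₁ A₀).comp ι₀))) a := fun a => by
    change Hom.baseChange ℂ (ιᵢ a) ≫ Hom.baseChange ℂ θ.hom =
      Hom.baseChange ℂ θ.hom ≫ Hom.baseChange ℂ ((((A₀.baseChange L₁).endConjugate γ).comp
        ((endBaseChange L₁ A₀).comp ι₀)) a)
    rw [← Hom.baseChange_comp, hθι a, Hom.baseChange_comp]
  -- `ξ* := θ_ℂ ∘ η` on `(A₁^γ) ⊗ ℂ`, with `ξ*(u) = (λ ≫ θ)_ℂ(ξ₁(u))`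
  obtain ⟨ξs, hξs⟩ : ∃ ξs : CMTypeUniformization Φ 𝔠 (((A₀.baseChange L₁).conjugate γ).baseChange ℂ)
      ((endBaseChange ℂ ((A₀.baseChange L₁).conjugate γ)).comp
        (((A₀.baseChange L₁).endConjugate γ).comp ((endBaseChange L₁ A₀).comp ι₀))),
      ∀ u : K, ξs.r u = AlgPoints.map (Hom.baseChange ℂ (lam ≫ θ.hom)).hom.hom.hom (ξ₁.r u) :=
    ⟨η.ofIso ((baseChangeFunctor L₁ ℂ).mapIso θ) hθ, fun u => by
      rw [CMTypeUniformization.ofIso_r, Functor.mapIso_hom, ← hlam u, ← AlgPoints.map_comp_apply,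
        Hom.baseChange_comp]
      rfl⟩
  obtain ⟨ξ₂, hξ₂⟩ := CMTypeUniformization.exists_conjugate_tower_target A₀ ι₀ γ σ hσ ξs
  exact ⟨ξ₂, fun u => by rw [hξ₂ u, hξs u]⟩

end Literature.NumberTheory.ComplexMultiplication

end
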